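import Literature.AlgebraicGeometry.Milne1999.SpecialLefschetzGroupInvariantsHolds
import Literature.AlgebraicGeometry.Milne1999.SpecialLefschetzGroupOneEqUnitaryCentralizer
import Literature.AlgebraicGeometry.Milne1999.LefschetzCentraliserPowers
import Literature.AlgebraicGeometry.Milne1999.LefschetzGroupProducts
import Literature.AlgebraicGeometry.Milne1999.CentraliserFixesDivisorClasses
import Literature.AlgebraicGeometry.Milne1999.LefschetzGroupCentraliserInclusion
import Literature.AlgebraicGeometry.HodgeTheory.LefschetzStandardUnconditionalDegrees
import Literature.AlgebraicGeometry.HodgeTheory.MotivatedClassesHodgeClassesHolds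
import HarnessLib

/-!
# Milne 1999, Thm. 5.9: the Lefschetz involution of a complex abelian variety is a Lefschetz correspondence;
# Lieberman's theorem `B(A)` (discharge of `HodgeTheory.Lieberman1968_lefschetzInvolution_algebraic_abelianVariety`)

Family `hodge`, layer `Literature/AlgebraicGeometry/Milne1999`, namespace `Literature.AlgebraicGeometry.Milne1999`.
Cell `pub-hodgecm2` (COR-CM), seat `lit-milne`, binder table `HOME/lit/milne.md` row M8 (Milne 1999a §5).
Theorems only: no definition, no named fact, no `sorry` (D-0026). Proves, by Milne's Lefschetz-group road, the
cited record `Literature.AlgebraicGeometry.HodgeTheory.Lieberman1968_lefschetzInvolution_algebraic_abelianVariety` of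
`HodgeTheory/LefschetzStandardConjectureFacts` (Grothendieck's standard conjecture `B(A)` in André's `*_L`-form,
`StandardConjectureBStar A.dim A.X η`, for EVERY complex abelian variety `A` and every `η`) as a LITERATURE theorem
(`…_holds`, importable below `Summits/`), together with Milne's finer statements: the Künneth class of `*_L` — and of
every correspondence commuting with `S(A)(ℂ)`, e.g. the Künneth components of the diagonal and of the graph of an
endomorphism — is a LEFSCHETZ class on `A × A` (Prop. 5.7, Thm. 5.9, Cor. 5.8, Cor. 5.6), not merely an algebraic one.
(A Summit-side proof of the same record by the Fourier–Poincaré-class road, Kleiman 2A11, exists in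
`Summits/HodgeConjecture/HodgeConjecture/Theorems/Ring2AbelianAllAndreLiebermanHolds`
(`Summit.HodgeConjecture.HodgeConjecture.Ring2.AbelianAll.lieberman1968_lefschetzInvolution_algebraic_abelianVariety_holds`);
Literature files cannot import it.)

## Source, verbatim

J. S. Milne, *Lefschetz classes on abelian varieties*, Duke Math. J. 96 (1999) 639–675
[`paper:doi-10-1215-s0012-7094-99-09620-5`, held; pp. 662–665 = held p0024–p0027]:

* p. 664 (Correspondences): "The map sending `u ∈ H^{2s}(X × Y)(s)` to the composite
  `H^*(X) → H^*(X × Y) → H^{*+2s}(X × Y)(s) → H^{*+2s-2d}(Y)(s − d)`, `d = dim X`, [`p^*`, `v ↦ v ∪ u`, `q_*`] is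
  an isomorphism `u ↦ ū : H^*(X × Y) → Hom(H^*(X), H^{*+2s−2d}(Y)(s − d))`. A cohomological correspondence
  `u ∈ H^*(X × Y)` is said to be Lefschetz if it lies in the subalgebra `D_hom(X × Y)_k` of `H^*(X × Y)`."
* **Proposition 5.7.** "Let `A` and `B` be abelian varieties over `Ω`. A cohomological correspondence `u` between
  `A` and `B` is Lefschetz if and only if `ū : H^*(A) → H^*(B)` commutes with the actions of `L(A × B)`."
* **Theorem 5.9.** "Let `A` be an abelian variety over `Ω`. The correspondences `Λ`, `ᶜΛ`, and `∗` between `A`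
  and itself are all Lefschetz." Proof (p. 665): "It is known (e.g., Kleiman 1968, p367) that `Λ`, regarded as
  a map of cohomology groups, is inverse to `L`. Since the latter is Lefschetz, it commutes with the action of
  `L(A)`, which implies that the same is true of `Λ`, which is therefore Lefschetz. Consequently, all elements of
  the `ℚ`-algebra `ℚ[L, Λ]` are Lefschetz. Since this algebra contains `ᶜΛ` and `∗` (Kleiman 1968, 1.4.4),
  this completes the proof."
* Proof of Prop. 5.4 (p. 663): "Because `H^{2g}(A)(g)` consists of Lefschetz classes—it is generated by the class
  of `D^g` for any ample divisor `D` on `A`—the action of `L(A)` on it is trivial"; §1 p. 643: "the diagonal action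
  of `C(A)` on `rV(A)` identifies `C(A)` with `C(A^r)` (as `k`-algebras with involution)"; Cor. 4.5 (p. 659):
  "`H^{2*}(A^r)(*)^{L(A)} = D_hom(A^r)_k`"; fn. 7 (p. 663): "For abelian varieties over `C`, Lieberman 1968 shows
  that (Betti) homological equivalence agrees with numerical equivalence on all algebraic cycles on abelian
  varieties."

André's `*_L` (the tree's `HodgeTheory.lefschetzInvolution`: degreewise `L^{d-a}` or its inverse, André 1996
§1.1) lies in `ℚ[L, Λ]` exactly like Kleiman's `∗`; the proof below runs Milne's argument for `*_L` directly.

## Proof assembled here (complex abelian variety `A` of dimension `n ≥ 1`, polarisation class `η`, `a + b = 2n`)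

1. (`exteriorPullback_lefschetzInvolution`) `*_L : Hᵃ → Hᵇ` commutes with the exterior action `⋀•u` of every
   `u ∈ GL(H¹(A(ℂ); ℂ))` with `⋀²u η = η` — "`L` […] commutes with the action of `L(A)`, which implies that the
   same is true of `Λ`" (`*_L` is `L^{j}` or `(L^{j})⁻¹` degreewise).
2. (`exteriorPullback_two_eq_self_of_mem_algebraicClasses`, from `CentraliserFixesDivisorClasses`) every
   `u ∈ S(A)(ℂ) = unitaryCentralizerGroup A h` (`h` a rational Kähler class) fixes `η` (a rational divisor class
   in the `ℂ`-span of the rational `(1,1)`-classes) and has `det u = 1`, i.e. acts trivially on `H^{2n}(A)`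
   (p. 663: "the action of `L(A)` on [`H^{2g}(A)(g)`] is trivial") — so `⋀•u` preserves the cup-product pairing
   (`cupPairing_exteriorPullback_exteriorPullback`).
3. (`sum_cross_exteriorPullback_eq_sum_cross`) the Künneth class `γ = Σⱼ pr₁^*(*_L yⱼ) ∪ pr₂^*(yⱼ^∨)` of `*_L` on
   `A × A` (`(yⱼ)`, `(yⱼ^∨)` a dual pair for the cup pairing `Hᵃ × Hᵇ → H^{2n} → ℂ`; Milne's `u ↦ ū`, Voisin I
   Lemma 11.41 / (11.11) on the tree's carriers) does not depend on the dual pair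
   (`PerfPairDuality.sum_dual_eq_sum_dual`), hence is unchanged when the dual pair is moved by `⋀•u` — and by
   1.–2. that move is the diagonal action `⋀•(u ⊕ u)` of `S(A × A)(ℂ)` (`exteriorPullback_prodBlockDiagEquiv_cross`).
4. (`exists_mem_unitaryCentralizerGroup_diagPow_eq`) `S(A^{r})(ℂ) = S(A)(ℂ)` diagonally for Milne's product
   polarization `Σᵢ prᵢ^* h` (§1 p. 643 with `exists_eq_diagPow_of_mem_centralizerGroup`, Cor. 4.7): every element of
   `unitaryCentralizerGroup (A.powSucc r) (powPolarizationClass A h r)` is `u^{⊕(r+1)}` with `u ∈ S(A)(h)`.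
5. Cor. 4.5 / Thm. 3.2 on `A × A` in `S(ℂ)`-form (`mem_divisorClassesSpan_of_forall_mem_unitaryCentralizerGroup` of
   `SpecialLefschetzGroupInvariantsHolds`): the Künneth class of every `φ : Hᵃ → Hᵇ` commuting with the `⋀•u`,
   `u ∈ S(A)(ℂ)`, is a Lefschetz class on `A × A` — Prop. 5.7 (⇐) in class form
   (`sum_cross_mem_divisorClassesSpan_of_forall_comm`); instances: `*_L` (Thm. 5.9,
   `sum_cross_lefschetzInvolution_mem_divisorClassesSpan`), the identity of `Hᵃ` (Cor. 5.8, the Künneth components of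
   the diagonal, `sum_cross_self_mem_divisorClassesSpan`), `α^*` for `α ∈ End(A)` (Cor. 5.6 with 5.8,
   `sum_cross_map_mem_divisorClassesSpan`).
6. Lefschetz classes are algebraic (Lefschetz `(1,1)`, `lefschetzOneOne_rational_holds`, and products:
   `AbelianVariety.divisorClassesSpan_le_algebraicClasses`; Milne fn. 7), and `*_L = (t⁻¹ γ)_*` for a non-zero `t`
   (`corrAction_sum_cross_apply`), so `*_L` is induced by an algebraic correspondence
   (`isAlgebraicCorrespondence_corrAction`): `StandardConjectureBStar A.dim A.X η`
   (`standardConjectureBStar_abelianVariety`), i.e. Lieberman's theorem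
   (`Lieberman1968_lefschetzInvolution_algebraic_abelianVariety_holds`). Dimension `0`: `*_L = L⁰`
   (`isAlgebraicCorrespondence_lefschetzInvolution_of_le`).

## References

* [Milne1999LefschetzClasses] J. S. Milne, Lefschetz classes on abelian varieties, Duke Math. J. 96 (1999)
  639–675: §1 p. 643, Thm. 3.2 (p. 653), Cor. 4.5 and Cor. 4.7 (p. 659), §5 Prop. 5.4, Cor. 5.6 (p. 663), p. 664,
  Prop. 5.7, Cor. 5.8, Thm. 5.9 (pp. 664–665), fn. 7 (p. 663).
* [Lieberman1968] D. Lieberman, Numerical and homological equivalence of algebraic cycles on Hodge manifolds,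
  Amer. J. Math. 90 (1968) 366–374 (main theorem: `B(A)`).
* [Kleiman1968AlgebraicCycles] S. Kleiman, Algebraic cycles and the Weil conjectures, in: Dix exposés sur la
  cohomologie des schémas (1968), §1.4.4, §2 and Appendix Thm. 2A11.
* [VoisinHodgeI2002] C. Voisin, Hodge Theory and Complex Algebraic Geometry I (CUP 2002), §11.3.3 Lemma 11.41
  with (11.11).
* [Andre1996Motifs] Y. André, Pour une théorie inconditionnelle des motifs, Publ. Math. IHÉS 83 (1996), §0.2,
  §1.1 (`*_L`), §2.1 (p. 14).
-/

noncomputable section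

open scoped BigOperators Manifold
open CategoryTheory MonoidalCategory CartesianMonoidalCategory
open Literature.AlgebraicTopology.SingularHomology
open Literature.AlgebraicGeometry.HodgeTheory
open Literature.AlgebraicGeometry.Motives
open Literature.AlgebraicGeometry.VanGeemen1994 (pullbackOne hodgeClassSpan)
open Literature.Barriers.HodgeConjecture (divisorClassesSpan)
open Literature.Geometry.Kaehler (lefschetzPow HasHardLefschetzProperty)

namespace Literature.AlgebraicGeometry.Milne1999

/-! ### §1 `*_L` commutes with the exterior action of an automorphism of `H¹` fixing `η` -/

section Involution

variable {A : AbelianVariety ℂ} (hΛ : HasExteriorCohomologyH1 ℂ (ComplexPoints A.X))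
  {L : complexBetti A.X 1 →ₗ[ℂ] complexBetti A.X 1}

/-- **`*_L` commutes with `⋀•L` as soon as `⋀²L` fixes `η`** (Milne, proof of Thm. 5.9: "`Λ`, regarded as a map of
cohomology groups, is inverse to `L`. Since the latter […] commutes with the action of `L(A)`, […] the same is
true of `Λ`"): for `η ∈ H²(A(ℂ); ℂ)` with hard Lefschetz in dimension `d`, `a + b = 2d`, and an endomorphism `L`
of `H¹(A(ℂ); ℂ)` with `⋀²L η = η`, `⋀ᵇL ∘ *_L = *_L ∘ ⋀ᵃL` on `Hᵃ(A(ℂ); ℂ)` — below the middle `*_L = Lʲ` commutes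
with the multiplicative `⋀•L` fixing `η`; above the middle `*_L = (Lʲ)⁻¹` and `Lʲ` is surjective onto the source.
[cite: Milne1999LefschetzClasses, Thm. 5.9 (proof, p. 665)] [cite: Andre1996Motifs, §1.1 (p. 10)] -/
theorem exteriorPullback_lefschetzInvolution {η : complexBetti A.X 2} {d : ℕ} (hL : HasHardLefschetzProperty η d)
    (hη : exteriorPullback hΛ L 2 η = η) {a b : ℕ} (hab : a + b = 2 * d) (x : complexBetti A.X a) :
    exteriorPullback hΛ L b (lefschetzInvolution hL hab x) =
      lefschetzInvolution hL hab (exteriorPullback hΛ L a x) := by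
  by_cases h : a ≤ d
  · obtain ⟨j, rfl⟩ : ∃ j, b = a + 2 * j := ⟨d - a, by omega⟩
    have hj : a + j = d := by omega
    rw [lefschetzInvolution_apply_of_le hL hj hab, lefschetzInvolution_apply_of_le hL hj hab,
      exteriorPullback_lefschetzPow hΛ hη a x j]
  · obtain ⟨j, rfl⟩ : ∃ j, a = b + 2 * j := ⟨d - b, by omega⟩
    have hj : b + j = d := by omega
    obtain ⟨y, rfl⟩ := (hL j b hj).2 x
    rw [lefschetzInvolution_lefschetzPow hL hj hab, exteriorPullback_lefschetzPow hΛ hη b y j,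
      lefschetzInvolution_lefschetzPow hL hj hab]

end Involution

/-! ### §2 `S(A)(ℂ)` fixes every divisor class and acts trivially in top degree -/

section UnitaryCentralizer

variable {A : AbelianVariety ℂ} {h : complexBetti A.X 2}

/-- **`⋀²u` fixes every class of `N¹ H²(A(ℂ); ℂ)`** (the `ℂ`-span of the divisor classes) for
`u ∈ S(A)(ℂ) = unitaryCentralizerGroup A h`, `h` rational with `s · h` Kähler: algebraic classes lie in the span of
the rational `(1,1)`-classes (`algebraicClasses_le_span_hodgeClasses`), each fixed by `⋀²u` (Milne Thm. 4.4,
proof p. 659: "`(γ, γ†γ)` […] fixes the class of `D` in `H²(A)(1)`";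
`exteriorPullback_two_eq_self_of_mem_unitaryCentralizerGroup`). In particular `⋀²u η = η` for every polarisation
class `η` ("Since [`L`] is Lefschetz, it commutes with the action of `L(A)`", proof of Thm. 5.9).
[cite: Milne1999LefschetzClasses, Thm. 4.4 (proof, p. 659) and Thm. 5.9 (proof, p. 665)] -/
theorem exteriorPullback_two_eq_self_of_mem_algebraicClasses (hQ : IsRationalClass h)
    (hK : ∃ s : ℝ, 0 < s ∧ IsKaehlerClass A.dim A.X ((s : ℂ) • h))
    {u : complexBetti A.X 1 ≃ₗ[ℂ] complexBetti A.X 1} (hu : u ∈ unitaryCentralizerGroup A h)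
    {c : complexBetti A.X 2} (hc : c ∈ algebraicClasses A.X 1) :
    exteriorPullback (AbelianVariety.hasExteriorCohomologyH1_complexPoints A)
      (u : complexBetti A.X 1 →ₗ[ℂ] complexBetti A.X 1) 2 c = c := by
  have hX : IsSmoothProjective A.dim A.X := AbelianVariety.isSmoothProjective_holds (A := A)
  have hspan : c ∈ Submodule.span ℂ {c : complexBetti A.X (2 * 1) |
      IsRationalClass c ∧ IsOfHodgeType A.dim A.X (2 * 1) 1 1 c} :=
    algebraicClasses_le_span_hodgeClasses hX 1 hc
  clear hc
  induction hspan using Submodule.span_induction with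
  | mem x hx => exact exteriorPullback_two_eq_self_of_mem_unitaryCentralizerGroup hQ hK hu hx.1 hx.2
  | zero => exact map_zero _
  | add x y _ _ hx hy => rw [map_add, hx, hy]
  | smul r x _ hx => rw [map_smul, hx]

/-- **`⋀•u` preserves the cup-product pairing `Hᵃ(A(ℂ)) × Hᵈ(A(ℂ)) → H^{2 dim A}(A(ℂ)) → ℂ`** for `u` with
`det u = 1` (e.g. `u ∈ S(A)(ℂ)`, `det_eq_one_of_mem_unitaryCentralizerGroup`): `⋀•u` is multiplicative and acts on the
top degree `H^{2 dim A} = ⋀^{2 dim A} H¹` by `det u` — Milne, proof of Prop. 5.4 (p. 663): "`H^{2g}(A)(g)` consists of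
Lefschetz classes […] the action of `L(A)` on it is trivial", used there with the projection formula exactly as here.
[cite: Milne1999LefschetzClasses, Prop. 5.4 (proof, p. 663)] [cite: HatcherAT2002, §3.2 Example 3.16] -/
theorem cupPairing_exteriorPullback_exteriorPullback (ν : HomologicalOrientation ℂ (ComplexPoints A.X) (2 * A.dim))
    (u : complexBetti A.X 1 ≃ₗ[ℂ] complexBetti A.X 1)
    (hdet : LinearMap.det (u : complexBetti A.X 1 →ₗ[ℂ] complexBetti A.X 1) = 1) {a d : ℕ}
    (had : a + d = 2 * A.dim) (x : complexBetti A.X a) (y : complexBetti A.X d) :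
    cupPairing ν had
        (exteriorPullback (AbelianVariety.hasExteriorCohomologyH1_complexPoints A)
          (u : complexBetti A.X 1 →ₗ[ℂ] complexBetti A.X 1) a x)
        (exteriorPullback (AbelianVariety.hasExteriorCohomologyH1_complexPoints A)
          (u : complexBetti A.X 1 →ₗ[ℂ] complexBetti A.X 1) d y) =
      cupPairing ν had x y := by
  have hΛ := AbelianVariety.hasExteriorCohomologyH1_complexPoints A
  rw [cupPairing_apply, cupPairing_apply, ← exteriorPullback_cupProduct,
    exteriorPullback_top hΛ _ (AbelianVariety.finrank_complexBetti_one A), hdet, one_smul]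

end UnitaryCentralizer

/-! ### §3 `S(A^{r})(ℂ)` is the diagonal `S(A)(ℂ)` for Milne's product polarization (§1 p. 643, Cor. 4.7) -/

section Diagonal

variable {A : AbelianVariety ℂ} {h : complexBetti A.X 2}

/-- **`S(A^{a+1})(ℂ) = S(A)(ℂ)` diagonally** (Milne §1 p. 643: "the diagonal action of `C(A)` on `rV(A)` identifies
`C(A)` with `C(A^r)` (as `k`-algebras with involution)", with `S = {γ | γ†γ = 1}`, §1 p. 644; Cor. 4.7): for
`0 < dim A` and `h` with `h^{dim A} ≠ 0`, every `U ∈ unitaryCentralizerGroup (A^{a+1}) (Σᵢ prᵢ^* h)` is `u^{⊕(a+1)}`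
for a (unique, `diagPow_injective`) `u ∈ unitaryCentralizerGroup A h` — `U = u^{⊕(a+1)}` with `u ∈ C(A)` by
`exists_eq_diagPow_of_mem_centralizerGroup`, and the last block of `U` preserves `Q_h`
(`centralizerGroup.restrictSndHom_mem_unitaryCentralizerGroup` on `A^{a+1} = A^{a} × A`). The converse is
`diagPow_mem_unitaryCentralizerGroup`. [cite: Milne1999LefschetzClasses, §1 pp. 643–644 and Cor. 4.7 (p. 659)] -/
theorem exists_mem_unitaryCentralizerGroup_diagPow_eq (hA0 : 0 < A.dim)
    (htop : lefschetzPow h (A.dim - 1) 2 h ≠ 0) :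
    ∀ (a : ℕ) (U : complexBetti (A.powSucc a).X 1 ≃ₗ[ℂ] complexBetti (A.powSucc a).X 1),
      U ∈ unitaryCentralizerGroup (A.powSucc a) (powPolarizationClass A h a) →
        ∃ u ∈ unitaryCentralizerGroup A h, diagPow A u a = U
  | 0, U, hU => ⟨U, hU, rfl⟩
  | a + 1, U, hU => by
    obtain ⟨u, hu, huU⟩ := exists_eq_diagPow_of_mem_centralizerGroup (a + 1) U hU.1
    refine ⟨u, ?_, huU⟩
    subst huU
    have hmem : prodBlockDiagEquiv (diagPow A u a) u ∈ centralizerGroup ((A.powSucc a).prod A) := hU.1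
    have hU' : ((⟨prodBlockDiagEquiv (diagPow A u a) u, hmem⟩ : centralizerGroup ((A.powSucc a).prod A)) :
        complexBetti ((A.powSucc a).prod A).X 1 ≃ₗ[ℂ] complexBetti ((A.powSucc a).prod A).X 1) ∈
          unitaryCentralizerGroup ((A.powSucc a).prod A)
            (prodPolarizationClass (A.powSucc a) A (powPolarizationClass A h a) h) := hU
    have hres := centralizerGroup.restrictSndHom_mem_unitaryCentralizerGroup
      (lefschetzPow_powPolarizationClass_self_ne_zero hA0 htop a) _ hU'
    rwa [centralizerGroup.restrictSndHom_prodBlockDiagEquiv hmem] at hres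

/-- **`S(A)(ℂ) ≅ S(A^{a+1})(ℂ)`**: the diagonal embedding `unitaryCentralizerGroup.diagPowHom` (`u ↦ u^{⊕(a+1)}`,
`LefschetzCentraliserPowers`) is surjective for Milne's product polarization, hence bijective (Milne §1 p. 643 /
Cor. 4.7: `(L(A^{r}), l) ≅ (L(A), l)`, restricted to `S = ker l`). [cite: Milne1999LefschetzClasses, §1 pp. 643–644 and Cor. 4.7 (p. 659)] -/
theorem unitaryCentralizerGroup.diagPowHom_bijective (hA0 : 0 < A.dim) (htop : lefschetzPow h (A.dim - 1) 2 h ≠ 0)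
    (a : ℕ) : Function.Bijective (unitaryCentralizerGroup.diagPowHom A h hA0 a) := by
  refine ⟨unitaryCentralizerGroup.diagPowHom_injective hA0 a, fun U ↦ ?_⟩
  obtain ⟨u, hu, e⟩ := exists_mem_unitaryCentralizerGroup_diagPow_eq hA0 htop a _ U.2
  exact ⟨⟨u, hu⟩, Subtype.ext e⟩

end Diagonal

/-! ### §4 The Künneth class of a linear map and its invariance under the diagonal action (Milne's `u ↦ ū`, p. 664) -/

section KunnethClass

variable {A : AbelianVariety ℂ}

/-- The projections of `A × A` are the cartesian projections of the underlying schemes. [folklore] -/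
private theorem fst_hom_eq (B C : AbelianVariety ℂ) : (AbelianVariety.fst B C).hom.hom.hom = fst B.X C.X := rfl

/-- The projections of `A × A` are the cartesian projections of the underlying schemes. [folklore] -/
private theorem snd_hom_eq (B C : AbelianVariety ℂ) : (AbelianVariety.snd B C).hom.hom.hom = snd B.X C.X := rfl

/-- **The diagonal action on a sum of cross products**: on `A × A`,
`⋀ᵏ(s ⊕ s) (Σⱼ pr₁^* vⱼ ∪ pr₂^* wⱼ) = Σⱼ pr₁^*(⋀ᵇs vⱼ) ∪ pr₂^*(⋀ᵈs wⱼ)` — the action of the diagonal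
`γ ∈ C(A) ⊂ C(A × A)` on `H^*(A × A) = H^*(A) ⊗ H^*(A)` (Milne p. 664: `L(A × B)` acts on the correspondences
`H^*(A × B)`; `exteriorPullback_prodBlockDiagEquiv_cross`). [cite: Milne1999LefschetzClasses, §5 p. 664 and §1 p. 643]
[cite: HatcherAT2002, §3.2 Thm. 3.16] -/
theorem exteriorPullback_prodBlockDiagEquiv_sum_cross (s : complexBetti A.X 1 ≃ₗ[ℂ] complexBetti A.X 1)
    {b d k : ℕ} (hbd : b + d = k) {ι : Type} [Fintype ι] (v : ι → complexBetti A.X b)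
    (w : ι → complexBetti A.X d) :
    exteriorPullback (AbelianVariety.hasExteriorCohomologyH1_complexPoints (A.prod A)) (prodBlockDiagEquiv s s).toLinearMap k
        (∑ j, cupProduct hbd (complexBetti.map (fst A.X A.X) b (v j)) (complexBetti.map (snd A.X A.X) d (w j))) =
      ∑ j, cupProduct hbd
        (complexBetti.map (fst A.X A.X) b
          (exteriorPullback (AbelianVariety.hasExteriorCohomologyH1_complexPoints A) s.toLinearMap b (v j)))
        (complexBetti.map (snd A.X A.X) d
          (exteriorPullback (AbelianVariety.hasExteriorCohomologyH1_complexPoints A) s.toLinearMap d (w j))) := by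
  rw [map_sum]
  refine Finset.sum_congr rfl fun j _ ↦ ?_
  rw [← fst_hom_eq, ← snd_hom_eq]
  exact exteriorPullback_prodBlockDiagEquiv_cross s s hbd (v j) (w j)

/-- **The Künneth class `Σⱼ pr₁^* φ(yⱼ) ∪ pr₂^* yⱼ^∨` of a linear map `φ : Hᵃ(A(ℂ)) → Hᵇ(A(ℂ))` is unchanged when
the dual pair `(yⱼ, yⱼ^∨)` (for the cup pairing `Hᵃ × Hᵈ → ℂ`, `a + d = 2 dim A`) is moved by `⋀•u`, for `u` of
determinant `1` commuting with `φ`** — Milne's bijection `u ↦ ū` (p. 664) is `L(A × A)`-equivariant, so `ū`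
commuting with the group means `u` is fixed (Prop. 5.7); on the tree's carriers: `(⋀ᵃu yⱼ, ⋀ᵈu yⱼ^∨)` is again a
dual pair (`cupPairing_exteriorPullback_exteriorPullback`) and the class does not depend on the dual pair
(`PerfPairDuality.sum_dual_eq_sum_dual`; Voisin I (11.11)). [cite: Milne1999LefschetzClasses, §5 p. 664 and Prop. 5.7]
[cite: VoisinHodgeI2002, §11.3.3 Lemma 11.41 with (11.11)] -/
theorem sum_cross_exteriorPullback_eq_sum_cross (μ : OrientationFamily)
    (u : complexBetti A.X 1 ≃ₗ[ℂ] complexBetti A.X 1)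
    (hdet : LinearMap.det (u : complexBetti A.X 1 →ₗ[ℂ] complexBetti A.X 1) = 1)
    {a b d e : ℕ} (had : a + d = 2 * A.dim) (hbd : b + d = 2 * e)
    (φ : complexBetti A.X a →ₗ[ℂ] complexBetti A.X b)
    (hφ : ∀ x, exteriorPullback (AbelianVariety.hasExteriorCohomologyH1_complexPoints A)
        (u : complexBetti A.X 1 →ₗ[ℂ] complexBetti A.X 1) b (φ x) =
      φ (exteriorPullback (AbelianVariety.hasExteriorCohomologyH1_complexPoints A)
        (u : complexBetti A.X 1 →ₗ[ℂ] complexBetti A.X 1) a x))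
    {ι : Type} [Fintype ι] [DecidableEq ι] (y : Module.Basis ι ℂ (complexBetti A.X a))
    {yd : ι → complexBetti A.X d}
    (hyd : ∀ i j, cupPairing (μ (AbelianVariety.isSmoothProjective_holds (A := A))) had (y i) (yd j) =
      if i = j then 1 else 0) :
    ∑ j, cupProduct hbd
        (complexBetti.map (fst A.X A.X) b
          (exteriorPullback (AbelianVariety.hasExteriorCohomologyH1_complexPoints A)
            (u : complexBetti A.X 1 →ₗ[ℂ] complexBetti A.X 1) b (φ (y j))))
        (complexBetti.map (snd A.X A.X) d
          (exteriorPullback (AbelianVariety.hasExteriorCohomologyH1_complexPoints A)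
            (u : complexBetti A.X 1 →ₗ[ℂ] complexBetti A.X 1) d (yd j))) =
      ∑ j, cupProduct hbd (complexBetti.map (fst A.X A.X) b (φ (y j))) (complexBetti.map (snd A.X A.X) d (yd j)) := by
  classical
  have hX : IsSmoothProjective A.dim A.X := AbelianVariety.isSmoothProjective_holds (A := A)
  have hΛ := AbelianVariety.hasExteriorCohomologyH1_complexPoints A
  -- the bilinear map `Φ(v, w) = pr₁^* φ(v) ∪ pr₂^* w`
  let Φ : complexBetti A.X a →ₗ[ℂ] complexBetti A.X d →ₗ[ℂ] complexBetti (A.X ⊗ A.X) (2 * e) :=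
    ((cupProduct hbd) ∘ₗ ((complexBetti.map (fst A.X A.X) b).hom ∘ₗ φ)).compl₂ (complexBetti.map (snd A.X A.X) d).hom
  have hΦ : ∀ v w, Φ v w =
      cupProduct hbd (complexBetti.map (fst A.X A.X) b (φ v)) (complexBetti.map (snd A.X A.X) d w) :=
    fun v w ↦ rfl
  -- the moved dual pair `(⋀ᵃu yⱼ, ⋀ᵈu yⱼ^∨)`
  let y' : Module.Basis ι ℂ (complexBetti A.X a) := y.map (exteriorPullbackEquiv hΛ u a)
  have hy' : ∀ j, y' j = exteriorPullback hΛ (u : complexBetti A.X 1 →ₗ[ℂ] complexBetti A.X 1) a (y j) :=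
    fun j ↦ by rw [Module.Basis.map_apply, exteriorPullbackEquiv_apply]
  have hyd' : ∀ i j, cupPairing (μ hX) had (y' i)
      (exteriorPullback hΛ (u : complexBetti A.X 1 →ₗ[ℂ] complexBetti A.X 1) d (yd j)) = if i = j then 1 else 0 := by
    intro i j
    rw [hy', cupPairing_exteriorPullback_exteriorPullback (μ hX) u hdet had, hyd]
  have key := PerfPairDuality.sum_dual_eq_sum_dual (isPerfPair_cupPairing_complexPoints μ hX had) y hyd y' hyd' Φ
  calc ∑ j, cupProduct hbd
        (complexBetti.map (fst A.X A.X) b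
          (exteriorPullback hΛ (u : complexBetti A.X 1 →ₗ[ℂ] complexBetti A.X 1) b (φ (y j))))
        (complexBetti.map (snd A.X A.X) d
          (exteriorPullback hΛ (u : complexBetti A.X 1 →ₗ[ℂ] complexBetti A.X 1) d (yd j)))
      = ∑ j, Φ (y' j) (exteriorPullback hΛ (u : complexBetti A.X 1 →ₗ[ℂ] complexBetti A.X 1) d (yd j)) :=
        Finset.sum_congr rfl fun j _ ↦ by rw [hΦ, hy', hφ]
    _ = ∑ i, Φ (y i) (yd i) := key.symm
    _ = _ := Finset.sum_congr rfl fun j _ ↦ hΦ _ _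

end KunnethClass

/-! ### §5 Prop. 5.7 (⇐) in class form; Thm. 5.9, Cor. 5.8 and Cor. 5.6: Lefschetz classes on `A × A` -/

section Lefschetz

variable (A : AbelianVariety ℂ)

/-- **Milne 1999, Prop. 5.7 (⇐), class form: a correspondence commuting with `S(A)(ℂ)` has a LEFSCHETZ Künneth class.**
For a complex abelian variety `A` of positive dimension `n`, a rational class `h` with a Kähler multiple `s · h`
(`S(A)(ℂ) = unitaryCentralizerGroup A h`), degrees `a + d = 2n`, `b + d = 2e`, and a `ℂ`-linear
`φ : Hᵃ(A(ℂ); ℂ) → Hᵇ(A(ℂ); ℂ)` with `⋀ᵇu ∘ φ = φ ∘ ⋀ᵃu` for every `u ∈ S(A)(h)`: for ANY dual pair `(yⱼ)`, `(yⱼ^∨)`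
of the cup pairing `Hᵃ × Hᵈ → ℂ` (`yⱼ` a basis, `⟨yᵢ ∪ yⱼ^∨, [A(ℂ)]⟩ = δᵢⱼ`), the Künneth class
`Σⱼ pr₁^* φ(yⱼ) ∪ pr₂^* yⱼ^∨ ∈ H^{2e}((A × A)(ℂ); ℂ)` (Milne's `u` with `ū ∝ φ`, p. 664; Voisin I (11.11)) lies in
`Dᵉ_hom(A × A)_ℂ = divisorClassesSpan (A × A).X (2n) e` ("`u` is Lefschetz if and only if `ū` commutes with the
actions of `L(A × B)`"). Proof: the class is fixed by `S(A × A)(ℂ) = S(A)(ℂ)^{diag}` for Milne's product polarization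
`pr₁^* h + pr₂^* h` (§2–§4), and the `S(A × A)`-invariants are the Lefschetz classes (Cor. 4.5 / Thm. 3.2 on `A × A`,
`mem_divisorClassesSpan_of_forall_mem_unitaryCentralizerGroup`).
[cite: Milne1999LefschetzClasses, Prop. 5.7 (p. 664), Cor. 4.5 (p. 659), §1 p. 643] [cite: VoisinHodgeI2002, §11.3.3 (11.11)] -/
theorem sum_cross_mem_divisorClassesSpan_of_forall_comm (hA0 : 0 < A.dim) {h : complexBetti A.X 2}
    (hQ : IsRationalClass h) (hK : ∃ s : ℝ, 0 < s ∧ IsKaehlerClass A.dim A.X ((s : ℂ) • h)) {a b d e : ℕ}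
    (had : a + d = 2 * A.dim) (hbd : b + d = 2 * e) (φ : complexBetti A.X a →ₗ[ℂ] complexBetti A.X b)
    (hφ : ∀ u ∈ unitaryCentralizerGroup A h, ∀ x,
      exteriorPullback (AbelianVariety.hasExteriorCohomologyH1_complexPoints A)
          (u : complexBetti A.X 1 →ₗ[ℂ] complexBetti A.X 1) b (φ x) =
        φ (exteriorPullback (AbelianVariety.hasExteriorCohomologyH1_complexPoints A)
          (u : complexBetti A.X 1 →ₗ[ℂ] complexBetti A.X 1) a x))
    (μ : OrientationFamily) {ι : Type} [Fintype ι] [DecidableEq ι] (y : Module.Basis ι ℂ (complexBetti A.X a))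
    {yd : ι → complexBetti A.X d}
    (hyd : ∀ i j, cupPairing (μ (AbelianVariety.isSmoothProjective_holds (A := A))) had (y i) (yd j) =
      if i = j then 1 else 0) :
    (∑ j, cupProduct hbd (complexBetti.map (fst A.X A.X) b (φ (y j))) (complexBetti.map (snd A.X A.X) d (yd j)) :
        complexBetti (A.X ⊗ A.X) (2 * e)) ∈
      divisorClassesSpan (A.prod A).X (A.prod A).dim e := by
  classical
  set γ : complexBetti (A.X ⊗ A.X) (2 * e) :=
    ∑ j, cupProduct hbd (complexBetti.map (fst A.X A.X) b (φ (y j))) (complexBetti.map (snd A.X A.X) d (yd j))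
    with hγ
  obtain ⟨s, hs, hKs⟩ := id hK
  have hnd := eq_zero_of_forall_polarizationPairingOne_eq_zero_of_isKaehlerClass_smul' hs.ne' hKs
  have hh : h ∈ hodgeClassSpan A.dim A.X 1 := mem_hodgeClassSpan_one_of_isKaehlerClass_smul hQ hs.ne' hKs
  have htop : lefschetzPow h (A.dim - 1) 2 h ≠ 0 := lefschetzPow_self_ne_zero_of_isKaehlerClass_smul hA0 hKs
  -- `γ` is fixed by `S(A × A)(ℂ) = S(A)(ℂ)^{diag}` for the product polarization `pr₁^* h + pr₂^* h` (§2–§4)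
  have key : ∀ U ∈ unitaryCentralizerGroup (A.powSucc 1) (powPolarizationClass A h 1),
      exteriorPullback (AbelianVariety.hasExteriorCohomologyH1_complexPoints (A.powSucc 1))
        (U : complexBetti (A.powSucc 1).X 1 →ₗ[ℂ] complexBetti (A.powSucc 1).X 1) (2 * e) γ = γ := by
    intro U hU
    obtain ⟨u, hu, rfl⟩ := exists_mem_unitaryCentralizerGroup_diagPow_eq hA0 htop 1 U hU
    have hdet : LinearMap.det (u : complexBetti A.X 1 →ₗ[ℂ] complexBetti A.X 1) = 1 :=
      det_eq_one_of_mem_unitaryCentralizerGroup hQ hK hu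
    -- `⋀•(u ⊕ u) γ = Σⱼ pr₁^*(⋀ᵇu φ(yⱼ)) ∪ pr₂^*(⋀ᵈu yⱼ^∨) = γ` (the carriers `H•((A × A)(ℂ))` and
    -- `H•((A.X ⊗ A.X)(ℂ))` agree definitionally; no `rw` across them)
    have h1 := exteriorPullback_prodBlockDiagEquiv_sum_cross u hbd (fun j ↦ φ (y j)) yd
    have h2 := sum_cross_exteriorPullback_eq_sum_cross μ u hdet had hbd φ (hφ u hu) y hyd
    rw [hγ]
    exact h1.trans h2
  -- hence a Lefschetz class on `A × A = A.powSucc 1` (Cor. 4.5 / Thm. 3.2 in `S(ℂ)`-form)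
  exact mem_divisorClassesSpan_of_forall_mem_unitaryCentralizerGroup (A.powSucc 1)
    (powPolarizationClass_mem_hodgeClassSpan hh 1)
    (eq_zero_of_forall_polarizationPairingOne_powPolarizationClass_eq_zero hA0 htop hnd 1) e γ key

/-- **Milne 1999, Thm. 5.9 for André's `*_L` ("the correspondences `Λ`, `ᶜΛ`, and `∗` between `A` and itself are all
Lefschetz"), on the tree's carriers**: for a complex abelian variety `A` of positive dimension `n`, a polarisation class
`η`, `a + b = 2n`, and ANY dual pair `(yⱼ)`, `(yⱼ^∨)` for the cup pairing `Hᵃ(A(ℂ)) × Hᵇ(A(ℂ)) → ℂ` (`yⱼ` a basis,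
`⟨yᵢ ∪ yⱼ^∨, [A(ℂ)]⟩ = δᵢⱼ`), the Künneth class `Σⱼ pr₁^*(*_L yⱼ) ∪ pr₂^*(yⱼ^∨) ∈ H^{2b}((A × A)(ℂ); ℂ)` of `*_L`
(Milne's `u` with `ū ∝ *_L`, p. 664) is a LEFSCHETZ class: it lies in `Dᵇ_hom(A × A)_ℂ =
divisorClassesSpan (A × A).X (2n) b`. Proof = Milne's: "`L` […] commutes with the action of `L(A)`, which implies that
the same is true of `Λ`" — here `*_L` commutes with `⋀•u` for `u ∈ S(A)(ℂ)` (§1 with §2: `u` fixes `η`) — and Prop. 5.7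
(`sum_cross_mem_divisorClassesSpan_of_forall_comm`, for a rational Kähler class `h` of `A`).
[cite: Milne1999LefschetzClasses, Thm. 5.9 and Prop. 5.7 (pp. 664–665), Cor. 4.5 (p. 659), §1 p. 643] -/
theorem sum_cross_lefschetzInvolution_mem_divisorClassesSpan (hA0 : 0 < A.dim) {η : complexBetti A.X 2}
    (hη : IsPolarizationClass A.dim A.X η) {a b : ℕ} (hab : a + b = 2 * A.dim) (hbd : b + b = 2 * b)
    (μ : OrientationFamily) {ι : Type} [Fintype ι] [DecidableEq ι] (y : Module.Basis ι ℂ (complexBetti A.X a))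
    {yd : ι → complexBetti A.X b}
    (hyd : ∀ i j, cupPairing (μ (AbelianVariety.isSmoothProjective_holds (A := A))) hab (y i) (yd j) =
      if i = j then 1 else 0) :
    (∑ j, cupProduct hbd (complexBetti.map (fst A.X A.X) b (lefschetzInvolution hη.hasHardLefschetz hab (y j)))
        (complexBetti.map (snd A.X A.X) b (yd j)) : complexBetti (A.X ⊗ A.X) (2 * b)) ∈
      divisorClassesSpan (A.prod A).X (A.prod A).dim b := by
  have hX : IsSmoothProjective A.dim A.X := AbelianVariety.isSmoothProjective_holds (A := A)
  -- a rational Kähler class `h` of `A`; `S(A)(ℂ) = unitaryCentralizerGroup A h` fixes `η` (§2), so `*_L` commutes (§1)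
  obtain ⟨D⟩ := nonempty_kaehlerRationalDatum hX
  have hQ : IsRationalClass D.Hη := D.isRationalClass_Hη
  have hK1 : IsKaehlerClass A.dim A.X (((1 : ℝ) : ℂ) • D.Hη) := by
    rw [Complex.ofReal_one, one_smul]
    exact D.isKaehlerClassVia.isKaehlerClass D.isNatural D.isMultiplicative
  have hK : ∃ s : ℝ, 0 < s ∧ IsKaehlerClass A.dim A.X ((s : ℂ) • D.Hη) := ⟨1, one_pos, hK1⟩
  exact sum_cross_mem_divisorClassesSpan_of_forall_comm A hA0 hQ hK hab hbd
    (lefschetzInvolution hη.hasHardLefschetz hab)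
    (fun u hu x ↦ exteriorPullback_lefschetzInvolution (AbelianVariety.hasExteriorCohomologyH1_complexPoints A)
      hη.hasHardLefschetz (exteriorPullback_two_eq_self_of_mem_algebraicClasses hQ hK hu hη.mem_algebraicClasses) hab x)
    μ y hyd

/-- **Milne 1999, Cor. 5.8: "the Künneth components of the diagonal are Lefschetz"** ("The projection operator
`H^*(A) → H^s(A)` commutes with the action of `L(A)`"), on the tree's carriers and in class form: for `A` of positive
dimension `n`, `a + d = 2n`, and ANY dual pair `(yⱼ)`, `(yⱼ^∨)` for the cup pairing `Hᵃ × Hᵈ → ℂ`, the class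
`Σⱼ pr₁^* yⱼ ∪ pr₂^* yⱼ^∨ ∈ H^{2n}((A × A)(ℂ); ℂ)` — the Künneth class of the identity of `Hᵃ(A(ℂ); ℂ)`, i.e. the
`(a, d)`-Künneth component of the diagonal class up to the normalisation of `u ↦ ū` — lies in `Dⁿ_hom(A × A)_ℂ`
(Prop. 5.7 with `φ = id`). [cite: Milne1999LefschetzClasses, Cor. 5.8 and Prop. 5.7 (p. 664)] -/
theorem sum_cross_self_mem_divisorClassesSpan (hA0 : 0 < A.dim) {a d : ℕ} (had : a + d = 2 * A.dim)
    (μ : OrientationFamily) {ι : Type} [Fintype ι] [DecidableEq ι] (y : Module.Basis ι ℂ (complexBetti A.X a))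
    {yd : ι → complexBetti A.X d}
    (hyd : ∀ i j, cupPairing (μ (AbelianVariety.isSmoothProjective_holds (A := A))) had (y i) (yd j) =
      if i = j then 1 else 0) :
    (∑ j, cupProduct had (complexBetti.map (fst A.X A.X) a (y j)) (complexBetti.map (snd A.X A.X) d (yd j)) :
        complexBetti (A.X ⊗ A.X) (2 * A.dim)) ∈
      divisorClassesSpan (A.prod A).X (A.prod A).dim A.dim := by
  have hX : IsSmoothProjective A.dim A.X := AbelianVariety.isSmoothProjective_holds (A := A)
  obtain ⟨D⟩ := nonempty_kaehlerRationalDatum hX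
  have hK1 : IsKaehlerClass A.dim A.X (((1 : ℝ) : ℂ) • D.Hη) := by
    rw [Complex.ofReal_one, one_smul]
    exact D.isKaehlerClassVia.isKaehlerClass D.isNatural D.isMultiplicative
  exact sum_cross_mem_divisorClassesSpan_of_forall_comm A hA0 D.isRationalClass_Hη ⟨1, one_pos, hK1⟩ had had
    LinearMap.id (fun _ _ _ ↦ rfl) μ y hyd

/-- **Milne 1999, Cor. 5.6 ("the graph of any regular map `α : A → B` of abelian varieties is Lefschetz") with Cor. 5.8,
for an endomorphism `α` of `A`, in class form on the tree's carriers**: for `A` of positive dimension `n`, `a + d = 2n`,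
and ANY dual pair `(yⱼ)`, `(yⱼ^∨)` for the cup pairing `Hᵃ × Hᵈ → ℂ`, the Künneth class
`Σⱼ pr₁^* α^*(yⱼ) ∪ pr₂^* yⱼ^∨ ∈ H^{2n}((A × A)(ℂ); ℂ)` of `α^* : Hᵃ(A(ℂ)) → Hᵃ(A(ℂ))` — the `(a, d)`-Künneth
component of the (transposed) graph class of `α`, up to the normalisation of `u ↦ ū` — lies in `Dⁿ_hom(A × A)_ℂ`:
`α^* = ⋀•(α^*|_{H¹})` commutes with `⋀•u` for `u ∈ S(A)(ℂ) ⊆ C(A)^×` ("whose elements commute with the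
endomorphisms of `A`", §1 p. 644), and Prop. 5.7 applies.
[cite: Milne1999LefschetzClasses, Cor. 5.6 (p. 663), Cor. 5.8 and Prop. 5.7 (p. 664), §1 p. 644] -/
theorem sum_cross_map_mem_divisorClassesSpan (hA0 : 0 < A.dim) (α : A ⟶ A) {a d : ℕ} (had : a + d = 2 * A.dim)
    (μ : OrientationFamily) {ι : Type} [Fintype ι] [DecidableEq ι] (y : Module.Basis ι ℂ (complexBetti A.X a))
    {yd : ι → complexBetti A.X d}
    (hyd : ∀ i j, cupPairing (μ (AbelianVariety.isSmoothProjective_holds (A := A))) had (y i) (yd j) =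
      if i = j then 1 else 0) :
    (∑ j, cupProduct had (complexBetti.map (fst A.X A.X) a (complexBetti.map α.hom.hom.hom a (y j)))
        (complexBetti.map (snd A.X A.X) d (yd j)) : complexBetti (A.X ⊗ A.X) (2 * A.dim)) ∈
      divisorClassesSpan (A.prod A).X (A.prod A).dim A.dim := by
  have hX : IsSmoothProjective A.dim A.X := AbelianVariety.isSmoothProjective_holds (A := A)
  have hΛ := AbelianVariety.hasExteriorCohomologyH1_complexPoints A
  obtain ⟨D⟩ := nonempty_kaehlerRationalDatum hX
  have hK1 : IsKaehlerClass A.dim A.X (((1 : ℝ) : ℂ) • D.Hη) := by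
    rw [Complex.ofReal_one, one_smul]
    exact D.isKaehlerClassVia.isKaehlerClass D.isNatural D.isMultiplicative
  -- `α^* = ⋀•(α^*|_{H¹})` commutes with `⋀•u` for `u ∈ C(A)^×`
  have hcomm : ∀ u ∈ unitaryCentralizerGroup A D.Hη, ∀ x : complexBetti A.X a,
      exteriorPullback hΛ (u : complexBetti A.X 1 →ₗ[ℂ] complexBetti A.X 1) a
          ((complexBetti.map α.hom.hom.hom a).hom x) =
        (complexBetti.map α.hom.hom.hom a).hom
          (exteriorPullback hΛ (u : complexBetti A.X 1 →ₗ[ℂ] complexBetti A.X 1) a x) := by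
    intro u hu x
    have hα : (complexBetti.map α.hom.hom.hom a).hom = exteriorPullback hΛ (pullbackOne A α) a :=
      (exteriorPullback_map hΛ (Motives.AlgPoints.mapContinuous (L := ℂ) α.hom.hom.hom) a).symm
    have hu1 : (u : complexBetti A.X 1 →ₗ[ℂ] complexBetti A.X 1).comp (pullbackOne A α) =
        (pullbackOne A α).comp (u : complexBetti A.X 1 →ₗ[ℂ] complexBetti A.X 1) :=
      LinearMap.ext fun v ↦ hu.1 α v
    have hc : (exteriorPullback hΛ (u : complexBetti A.X 1 →ₗ[ℂ] complexBetti A.X 1) a).comp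
          (exteriorPullback hΛ (pullbackOne A α) a) =
        (exteriorPullback hΛ (pullbackOne A α) a).comp
          (exteriorPullback hΛ (u : complexBetti A.X 1 →ₗ[ℂ] complexBetti A.X 1) a) := by
      rw [← exteriorPullback_comp hΛ hΛ, hu1, exteriorPullback_comp hΛ hΛ]
    rw [hα]
    exact LinearMap.congr_fun hc x
  exact sum_cross_mem_divisorClassesSpan_of_forall_comm A hA0 D.isRationalClass_Hη ⟨1, one_pos, hK1⟩ had had
    (complexBetti.map α.hom.hom.hom a).hom hcomm μ y hyd

end Lefschetz

/-! ### §6 Theorem 5.9 ⇒ Lieberman: `B(A)` for every complex abelian variety -/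

section Main

/-- **Grothendieck's `B(A)` for every complex abelian variety `A`, in André's `*_L`-form** (Lieberman 1968; Milne
1999 Thm. 5.9 with fn. 7 / Lefschetz `(1,1)`: Lefschetz classes are algebraic): for every polarisation class `η` of
the `n`-dimensional `A` and all `a + b = 2n`, André's `*_L : Hᵃ(A(ℂ); ℂ) → Hᵇ(A(ℂ); ℂ)` is induced by an ALGEBRAIC
class on `A × A` — its Künneth class `γ = Σⱼ pr₁^*(*_L yⱼ) ∪ pr₂^*(yⱼ^∨)` is a Lefschetz class
(`sum_cross_lefschetzInvolution_mem_divisorClassesSpan`), hence lies in `Nᵇ H^{2b}((A × A)(ℂ); ℂ)`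
(`AbelianVariety.divisorClassesSpan_le_algebraicClasses`, `lefschetzOneOne_rational_holds`), and
`*_L = (t⁻¹ • γ)_*` with `t ≠ 0` (`corrAction_sum_cross_apply`; Milne p. 664 "`u ↦ ū` is an isomorphism").
Dimension `0`: `*_L = L⁰ = Δ_*` (`isAlgebraicCorrespondence_lefschetzInvolution_of_le`).
[cite: Milne1999LefschetzClasses, Thm. 5.9 and Prop. 5.7 (pp. 664–665), Cor. 4.5 (p. 659), fn. 7 (p. 663)]
[cite: Lieberman1968, main theorem (B(A)), pp. 366–374] [cite: Kleiman1968AlgebraicCycles, Appendix to §2, Thm. 2A11] -/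
theorem standardConjectureBStar_abelianVariety (A : AbelianVariety ℂ) (η : complexBetti A.X 2) :
    StandardConjectureBStar A.dim A.X η := by
  intro hη a b hab
  classical
  have hX : IsSmoothProjective A.dim A.X := AbelianVariety.isSmoothProjective_holds (A := A)
  -- dimension `0`: `a = b = 0` and `*_L = L⁰`
  rcases Nat.eq_zero_or_pos A.dim with hA | hA0
  · exact isAlgebraicCorrespondence_lefschetzInvolution_of_le hX hη hab (by omega)
  -- Milne's road
  let μ : OrientationFamily := fun _ _ h ↦ Classical.choice (Motives.ComplexPoints.isOrientableOver ℂ h)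
  set φ := lefschetzInvolution hη.hasHardLefschetz hab with hφdef
  have hbd : b + b = 2 * b := by ring
  have hab' : a + 2 * b = b + 2 * A.dim := by omega
  -- a basis of `Hᵃ(A(ℂ); ℂ)` and a dual family in `Hᵇ(A(ℂ); ℂ)` for the cup pairing
  letI := hX.chartedSpace
  haveI := Motives.ComplexPoints.compactSpace_of_isSmoothProjective hX
  haveI := Motives.ComplexPoints.t2Space_of_isSmoothProjective hX
  haveI : Module.Finite ℂ (complexBetti A.X a) :=
    finite_singularCohomology_of_compact_chartedSpace ℂ ℂ (d := 2 * A.dim) a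
  let y := Module.finBasis ℂ (complexBetti A.X a)
  obtain ⟨yd, hyd⟩ := PerfPairDuality.exists_dual (isPerfPair_cupPairing_complexPoints μ hX hab) y
  -- the Künneth class of `*_L` on `A × A` is a Lefschetz class (Thm. 5.9), hence algebraic (fn. 7 / Lefschetz (1,1))
  have hdiv := sum_cross_lefschetzInvolution_mem_divisorClassesSpan A hA0 hη hab hbd μ y hyd
  set γ : complexBetti (A.X ⊗ A.X) (2 * b) :=
    ∑ j, cupProduct hbd (complexBetti.map (fst A.X A.X) b (φ (y j))) (complexBetti.map (snd A.X A.X) b (yd j))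
    with hγ
  have hγalg : γ ∈ algebraicClasses (A.X ⊗ A.X) b :=
    AbelianVariety.divisorClassesSpan_le_algebraicClasses (A.prod A)
      (fun c hc hc' ↦ lefschetzOneOne_rational_holds
        (AbelianVariety.isSmoothProjective_holds (A := A.prod A)) c hc hc') b hdiv
  -- its action is a non-zero multiple of `*_L`
  obtain ⟨ω₁, lam, hlam0, hω₁, hlam⟩ := exists_complexGysin_fst_map_snd_eq_smul_one μ hX hX
  have hact : corrAction μ hX hX hab' γ = ((-1 : ℂ) ^ (a * b) * lam) • φ := by
    refine LinearMap.ext fun v ↦ ?_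
    rw [hγ, corrAction_sum_cross_apply μ hX hX hab' hab hbd φ y yd hω₁ hlam v, LinearMap.smul_apply]
    congr 1
    conv_rhs => rw [PerfPairDuality.eq_sum_smul_self y hyd v]
    rw [map_sum]
    simp_rw [map_smul]
  -- conclusion: `*_L = (t⁻¹ • γ)_*` is induced by an algebraic correspondence
  have ht : ((-1 : ℂ) ^ (a * b) * lam) ≠ 0 :=
    mul_ne_zero (pow_ne_zero _ (neg_ne_zero.2 one_ne_zero)) hlam0
  have hφγ : φ = corrAction μ hX hX hab' ((((-1 : ℂ) ^ (a * b) * lam))⁻¹ • γ) := by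
    rw [map_smul, hact, smul_smul, inv_mul_cancel₀ ht, one_smul]
  rw [hφγ]
  exact isAlgebraicCorrespondence_corrAction μ (OrientationFamily.hasPoincareDuality μ) hX hX hab'
    (show b + a = 2 * A.dim by omega) (Submodule.smul_mem _ _ hγalg)

/-- **Lieberman's theorem — discharge of the record
`HodgeTheory.Lieberman1968_lefschetzInvolution_algebraic_abelianVariety`**: Grothendieck's standard conjecture of
Lefschetz type `B(A)` holds for every complex abelian variety `A` (and every `η ∈ H²(A(ℂ); ℂ)`: the predicate is
vacuous unless `η` is a polarisation class), on the real carriers, by Milne 1999 Thm. 5.9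
(`standardConjectureBStar_abelianVariety`) — the Literature-side theorem (a Summit-side proof by the
Fourier–Poincaré-class road exists under `Summits/…/Ring2AbelianAllAndreLiebermanHolds`, not importable here);
Literature users of the record (`Hyperkaehler/K3HilbertTypeLefschetzStandard`,
`Tankeev2011/LefschetzStandardAbelianSurfacePencils`, `HodgeTheory/LefschetzStandardUnconditionalDegrees`) may cite
this theorem instead.
[cite: Lieberman1968, main theorem (B(A)), pp. 366–374] [cite: Milne1999LefschetzClasses, Thm. 5.9 (pp. 664–665) and fn. 7 (p. 663)]
[cite: Kleiman1968AlgebraicCycles, Appendix to §2, Thm. 2A11] -/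
theorem _root_.Literature.AlgebraicGeometry.HodgeTheory.Lieberman1968_lefschetzInvolution_algebraic_abelianVariety_holds :
    Lieberman1968_lefschetzInvolution_algebraic_abelianVariety :=
  fun A η ↦ standardConjectureBStar_abelianVariety A η

end Main

end Literature.AlgebraicGeometry.Milne1999

end
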